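import Literature.Geometry.Riemannian.AdmissibleFillIn
import HarnessLib

/-!
# Rigidity of `Ric ≥ n` fill-ins of a geodesic ball of the open hemisphere (Hang–Wang 2009, Thm 3)

F. Hang, X. Wang, *Rigidity theorems for compact manifolds with boundary and positive Ricci
curvature*, J. Geom. Anal. 19 (2009) 628–642 = arXiv:0911.0380 [HangWang2009].  Named fact
(D-0014) requested by route SmoothPoincare4/RicciFat (items `CorkSymmetrisation`,
`FatBeyondWeylGap`, `RicciFatSphere`; `wi-39229`), where it acts as a BARRIER: a `Ric ≥ 3` metric
on a closed `4`-manifold which is the round metric outside a compact domain contained in an open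
hemisphere is globally round.

**Theorem 3** (arXiv p. 3, verbatim): "Let `(M, g)` be a smooth compact Riemannian manifold with
boundary `∂M = Σ` and `Ω̄ ⊂ S^n_+` is a compact domain with smooth boundary in the open hemisphere.
Suppose `Ric ≥ (n − 1) g`; there is an isometric embedding `ι : (Σ, g_Σ) → ∂Ω̄`; `Π ≥ Π₀ ∘ ι`, here
`Π` the second fundamental form of `Σ` in `M` and `Π₀` is the second fundamental form of `∂Ω̄` in
`S^n_+`.  Then `(M, g)` is isometric to `(Ω̄, g_{S^n_+})`."  Conventions (p. 3): "Let `ν` be the outer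
unit normal field of `Σ` in `M` … `Π(X, Y) = ⟨∇_X ν, Y⟩`."  (Theorem 2 is the endpoint `Ω̄` = the
closed hemisphere, `Σ ≅ S^{n−1}`, `Π ≥ 0`.)

## This rendering: the BALL case, in the vocabulary of `AdmissibleFillIn.lean`

`Ω̄ = B̄_r(N)`, the closed geodesic ball of radius `0 < r < π/2` about a point `N` of the unit round
sphere (a compact domain with smooth boundary in the open hemisphere about `N`): its boundary is the
round sphere of radius `sin r` and `Π₀ = cot r · g|∂B̄_r` for the outer unit normal, so the hypotheses
of Thm 3 read `HasRoundBoundary g b (sin r)` (an isometry of `(∂Δ, g|∂Δ)` onto the round sphere of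
radius `sin r` IS an isometric embedding onto `∂B̄_r`) and `HasBoundaryConvexityBound g b (cot r)`
(`Π ≥ cot r · g|Σ = Π₀ ∘ ι`, same convention `Π(X,Y) = ⟨∇_X ν, Y⟩` for the OUTER normal, loc. cit.),
i.e. `IsAdmissibleFillIn g b (sin r) (cot r)`.  The fill-in is an `(n+1)`-manifold with boundary `Δ`
modelled on `𝓡∂ (n + 1)` (so Hang–Wang's dimension is `n + 1 ≥ 2` and the Ricci bound is
`Ric ≥ n g`), compact and connected (connectedness is implicit in the printed statement), with a
boundary datum `b` (the whole boundary, `BoundaryData.range_incl`) and a `C^∞` Riemannian metric `h`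
carrying its Levi-Civita connection.  The conclusion "isometric to `(B̄_r, g_S)`" is rendered as: there
are a unit vector `N ∈ ℝⁿ⁺²` and an injective isometric immersion `Φ : (Δ, h) → (Sⁿ⁺¹, g_round)`
(`PseudoRiemannianMetric.IsIsometricImmersion`, the tree's `roundMetric` on Mathlib's unit sphere)
whose image is the closed cap `{p ∈ Sⁿ⁺¹ : ⟪p, N⟫ ≥ cos r} = B̄_r(N)` — a Riemannian isometry of
`(Δ, h)` onto `(B̄_r(N), g_round)`.  Named fact (D-0014); general domains `Ω̄` are not rendered.
-- TODO(general form): arbitrary compact smooth domains `Ω̄` of the open hemisphere (Thm 3 as printed).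

## References

* [HangWang2009] F. Hang, X. Wang, J. Geom. Anal. 19 (2009) 628–642 = arXiv:0911.0380, Thm. 3 and
  the conventions paragraph (arXiv p. 3); Thm. 2 (hemisphere endpoint).
* [ONeill1983] B. O'Neill, *Semi-Riemannian geometry* (1983), Ch. 3, Def. 3.4 and p. 58
  (isometries, round spheres), Ch. 4, pp. 97–107 (shape operator).
-/

noncomputable section

open Bundle Set Metric Module Function
open scoped Manifold ContDiff Topology RealInnerProductSpace

namespace Literature.Geometry.Riemannian

open Lorentzian Lorentzian.PseudoRiemannianMetric
open Literature.Topology.FourManifolds (BoundaryData)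

/-- **Hang–Wang 2009, Thm 3 — geodesic-ball case: a compact connected `Ric ≥ n` fill-in of the
round `n`-sphere of radius `sin r` with `Π ≥ cot r · g|∂` (`0 < r < π/2`) is isometric to the closed
geodesic ball `B̄_r ⊂ Sⁿ⁺¹`.**  For `n ≥ 1`, `0 < r < π/2`, a compact connected `C^∞` `(n+1)`-manifold
with boundary `Δ` (Hausdorff, second countable), a boundary datum `b` and a `C^∞` Riemannian metric
`h` on `TΔ` with its Levi-Civita connection such that `Ric_h ≥ n h` (`HasRicciLowerBound`) and
`(Δ, h)` is an admissible fill-in of parameters `(sin r, cot r)` (`IsAdmissibleFillIn`: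
`(∂Δ, h|∂Δ)` isometric to the round `Sⁿ(sin r)` and `Π ≥ cot r · h|∂Δ` for the outer unit normal,
`Π(X,Y) = ⟨∇_X ν, Y⟩`), there are a unit vector `N ∈ ℝⁿ⁺²` and an injective isometric immersion
`Φ : (Δ, h) → (Sⁿ⁺¹, g_round)` onto the closed cap `{p : ⟪p, N⟫ ≥ cos r}` (the closed geodesic ball
of radius `r` about `N`), i.e. `(Δ, h)` is isometric to `(B̄_r, g_{Sⁿ⁺¹})`.  Printed (Thm 3): "`(M, g)`
smooth compact with boundary `Σ`, `Ω̄ ⊂ S^n_+` a compact domain with smooth boundary in the open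
hemisphere, `Ric ≥ (n−1)g`, an isometric embedding `ι : (Σ, g_Σ) → ∂Ω̄`, `Π ≥ Π₀ ∘ ι` ⟹ `(M, g)` is
isometric to `(Ω̄, g_{S^n_+})`", specialised to `Ω̄ = B̄_r`, `r < π/2` (`∂B̄_r = Sⁿ(sin r)`,
`Π₀ = cot r · g|∂B̄_r`). Named fact (D-0014).
[cite: HangWang2009, Thm. 3 (arXiv p. 3) with the conventions paragraph (p. 3)] -/
def HangWang2009_ballFillIn_rigidity : Prop :=
  ∀ (n : ℕ) (Δ : Type) [TopologicalSpace Δ] [T2Space Δ] [SecondCountableTopology Δ]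
    [ChartedSpace (EuclideanHalfSpace (n + 1)) Δ] [IsManifold (𝓡∂ (n + 1)) ∞ Δ] [CompactSpace Δ]
    [ConnectedSpace Δ] (b : BoundaryData (𝓡∂ (n + 1)) Δ (𝓡 n))
    (h : ContMDiffRiemannianMetric (𝓡∂ (n + 1)) ∞ (EuclideanSpace ℝ (Fin (n + 1)))
      (TangentSpace (𝓡∂ (n + 1)) : Δ → Type _))
    [(ofRiemannian h).HasLeviCivita] (r : ℝ),
    1 ≤ n → 0 < r → r < Real.pi / 2 →
    HasRicciLowerBound (ofRiemannian h) n →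
    IsAdmissibleFillIn (ofRiemannian h) b (Real.sin r) (Real.cot r) →
      haveI : Fact (finrank ℝ (EuclideanSpace ℝ (Fin (n + 2))) = n + 1 + 1) :=
        ⟨finrank_euclideanSpace_fin⟩
      ∃ (N : EuclideanSpace ℝ (Fin (n + 2)))
        (Φ : Δ → sphere (0 : EuclideanSpace ℝ (Fin (n + 2))) 1),
        ‖N‖ = 1 ∧ Injective Φ ∧
        IsIsometricImmersion (ofRiemannian h) (roundMetric (n := n + 1) (EuclideanSpace ℝ (Fin (n + 2)))) Φ ∧
        range Φ = {p | Real.cos r ≤ ⟪(p : EuclideanSpace ℝ (Fin (n + 2))), N⟫}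

end Literature.Geometry.Riemannian

end
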